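import Summits.NavierStokesRegularity.FluidComputer.CriticalDivergence
import Summits.NavierStokesRegularity.FluidComputer.CriticalFloor
import Summits.NavierStokesRegularity.FluidComputer.BlockAmplitudeCeiling
import HarnessLib

/-!
# Fluid computer — the CRITICAL FACE of the level dictionary, III: LEVEL CURRENCY (L29)

HONEST FRAMING (cell `pub-fluidc`, verbatim): *low prior, high value-of-information experiment on Tao's
machine paradigm; NOT a claim that NS blows up.* Theorem side of the cell; nothing here is evidence of blow-up.
`CriticalDivergence` (L27: `‖u(t)‖_{L³} → ∞` as `t ↑ T`) and `CriticalFloor` (L28: `‖u(t)‖_{L³} > δν` at every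
instant) speak the `L³` currency; the dictionary speaks LEVELS — the Littlewood–Paley blocks `Δ̇_j`, block energies
`a_j = ‖Δ̇_j u‖₂` and block sups `s_j = ‖Δ̇_j u‖_∞`. This module is the exchange. For a field `v ∈ L² ∩ L³(ℝ³)`:

* `eLpNorm_three_le_tsum_block` — Littlewood–Paley summation in `L³`: `‖v‖₃ ≤ ∑_j ‖Δ̇_j v‖₃`
  (BCD Prop. 2.12, the tree's `eLpNormDistrib_le_tsum_lpBlock`, read through the distribution of `v`);
* `block_three_pow_le` / `block_three_le_rpow` — interpolation on a block: `‖Δ̇_j v‖₃³ ≤ s_j a_j²`;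
* `eLpNorm_three_le_tsum_mixed` — hence **`‖v‖₃ ≤ ∑_j (s_j a_j²)^{1/3}`**, the critical size in the dictionary's OWN
  two currencies (each summand `(s_j a_j²)^{1/3}` is scale-invariant: `s_j ↦ λ s_j`, `a_j ↦ λ^{-1/2} a_j`);
* `exists_eLpNorm_three_le_tsum_besovHalf` — and by Bernstein (`s_j ≤ C_B 2^{3j/2} a_j`,
  `BlockAmplitudeCeiling.exists_blockSup_le_blockL2`) **`‖v‖₃ ≤ C_B^{1/3} ∑_j 2^{j/2} a_j`**, the `Ḃ^{1/2}_{2,1}`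
  currency (critical weights `2^{j/2}`, half-way between the energy `∑ a_j²` and the enstrophy `∑ 4^j a_j²`).

Along every maximal smooth solution `(u, p)` of the unforced Navier–Stokes system on `ℝ³ × [0, T)` (`ν > 0`)
which is Leray–Hopf from `u 0` this yields:

* `mixed_level_floor`, `besovHalf_level_floor` (**L29 — THE CRITICAL LEVEL FLOORS**): absolute `δ, δ'' > 0` with
  `δ ν < ∑_j (s_j(t) a_j(t)²)^{1/3}` and `δ'' ν < ∑_j 2^{j/2} a_j(t)` at EVERY `t ∈ (0, T)` — never critically small,
  in level currency, at any instant;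
* `mixed_level_tendsto_top`, `besovHalf_level_tendsto_top` (**L29′ — THE CRITICAL LEVEL DIVERGENCE**): both sums
  tend to `∞` as `t ↑ T`;
* `besovHalf_tail_tendsto_top` (**L29″ — ABOVE EVERY FIXED LEVEL**): for every `J ∈ ℤ` the critically weighted
  tail `∑_{n≥0} 2^{(J+n)/2} a_{J+n}(t) → ∞` as `t ↑ T` (the levels below `J` hold at most `C₂‖u(0)‖₂ 2^{(J−1)/2} G½`,
  `G½ = ∑_n 2^{-n/2}`, by the energy class). By Cauchy–Schwarz
  `(∑_{j≥J} 2^{j/2} a_j)² ≤ 2^{1−J} ∑_{j≥J} 4^j a_j²`, so this divergence is, level by level, STRONGER than the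
  enstrophy-tail divergence L26 (`LerayTailDivergence`), which it implies (the comparison itself is not formalised
  here); and it is scale-free — no rate, no `ν`.

Reading for the atlas. `(s_j a_j²)^{1/3}` and `2^{j/2} a_j` are the CRITICAL ROWS of a level table: the products of
the amplitude row (`s_j`, Cheskidov–Shvydkoy saturation currency) and the energy row (`a_j`) with the weights that
make them dimensionless under the Navier–Stokes scaling. The necessities say: summed over levels, these rows are
bounded below by `δν` at every instant and diverge at the lifespan, and the divergence sits above every fixed
level. HONEST SIZE NOTE: `δ` (Kato), `C_B`, `C₂` inexplicit; words, not numbers at the cell's levels. Necessity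
only; nothing about sufficiency. 0 sorry; no new definitions, no named facts.

## References

* H. Bahouri, J.-Y. Chemin, R. Danchin, *Fourier Analysis and Nonlinear PDE*, Springer 2011, Lemma 2.1,
  Prop. 2.12, Thm. 2.34. [BahouriCheminDanchin2011]
* G. Seregin, Comm. Math. Phys. 312 (2012) 833–845, Thm. 1.1. [Seregin2012]
* T. Kato, Math. Z. 187 (1984) 471–480, Thms. 2 and 4. [Kato1984MathZ]
-/

noncomputable section

open MeasureTheory Set Function Filter Topology Metric
open scoped ENNReal NNReal SchwartzMap
open Literature.Analysis.FluidPDE Literature.Analysis.FunctionSpaces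
open Summit.NavierStokesRegularity.FluidComputer.BlockAmplitudeCeiling
open Summit.NavierStokesRegularity.FluidComputer.CriticalDivergence
open Summit.NavierStokesRegularity.FluidComputer.CriticalFloor

namespace Summit.NavierStokesRegularity.FluidComputer.CriticalLevels

/-! ## Two filter lemmas: divergence passes through finite constants -/

/-- If `f → ∞` along a filter and eventually `f ≤ C g` with a finite constant `C`, then `g → ∞`. [folklore] -/
theorem tendsto_top_of_le_const_mul {α : Type*} {l : Filter α} {f g : α → ℝ≥0∞} {C : ℝ≥0}
    (hf : Tendsto f l (𝓝 ∞)) (hle : ∀ᶠ x in l, f x ≤ (C : ℝ≥0∞) * g x) : Tendsto g l (𝓝 ∞) := by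
  have hC : Tendsto (fun x => (C : ℝ≥0∞) * g x) l (𝓝 ∞) := tendsto_nhds_top_mono hf hle
  refine ENNReal.tendsto_nhds_top_iff_nnreal.2 fun M => ?_
  filter_upwards [ENNReal.tendsto_nhds_top_iff_nnreal.1 hC (C * M)] with x hx
  by_contra hle'
  rw [not_lt] at hle'
  have : (C : ℝ≥0∞) * g x ≤ (C : ℝ≥0∞) * (M : ℝ≥0∞) := mul_le_mul' le_rfl hle'
  rw [← ENNReal.coe_mul] at this
  exact absurd (hx.trans_le this) (lt_irrefl _)

/-- If `f → ∞` along a filter and eventually `f ≤ H + g` with `H` finite, then `g → ∞`. [folklore] -/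
theorem tendsto_top_of_le_add {α : Type*} {l : Filter α} {f g : α → ℝ≥0∞} {H : ℝ≥0∞} (hH : H ≠ ⊤)
    (hf : Tendsto f l (𝓝 ∞)) (hle : ∀ᶠ x in l, f x ≤ H + g x) : Tendsto g l (𝓝 ∞) := by
  have hHg : Tendsto (fun x => H + g x) l (𝓝 ∞) := tendsto_nhds_top_mono hf hle
  refine ENNReal.tendsto_nhds_top_iff_nnreal.2 fun M => ?_
  filter_upwards [ENNReal.tendsto_nhds_top_iff_nnreal.1 hHg (H.toNNReal + M)] with x hx
  by_contra hle'
  rw [not_lt] at hle'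
  have : H + g x ≤ (H.toNNReal : ℝ≥0∞) + (M : ℝ≥0∞) := by
    rw [ENNReal.coe_toNNReal hH]
    exact add_le_add le_rfl hle'
  rw [← ENNReal.coe_add] at this
  exact absurd (hx.trans_le this) (lt_irrefl _)

/-! ## The Littlewood–Paley bridge in `L³` -/

/-- **Littlewood–Paley summation in `L³`**: for `v ∈ L² ∩ L³(ℝ³; ℝ³)`, `‖v‖_{L³} ≤ ∑_{j∈ℤ} ‖Δ̇_j v‖_{L³}` (in
`[0, ∞]`). The distribution of the `L²` field `v` has vanishing low-frequency cut-offs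
(`tendsto_lowFreqCutoff_of_memLp_two_holds`), so the `ℓ¹`-Minkowski bound `eLpNormDistrib_le_tsum_lpBlock` applies,
and the distributional `L³` norms are the function norms (`IsDistributionOf.eLpNormDistrib_eq`,
`IsDistributionOf.eLpNormDistrib_lpBlock_eq`; blocks of an `L³` field are `L³` fields, `memLp_blockFn`).
[cite: BahouriCheminDanchin2011, Prop. 2.12] -/
theorem eLpNorm_three_le_tsum_block {v : EuclideanSpace ℝ (Fin 3) → EuclideanSpace ℝ (Fin 3)}
    (hv2 : MemLp v 2 volume) (hv3 : MemLp v 3 volume) :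
    eLpNorm v 3 volume ≤ ∑' j : ℤ, eLpNorm (blockFn j v) 3 volume := by
  haveI : Fact (1 ≤ (3 : ℝ≥0∞)) := ⟨by norm_num⟩
  set V : 𝓢'(EuclideanSpace ℝ (Fin 3), EuclideanSpace ℂ (Fin 3)) :=
    Lp.toTemperedDistribution ((memLp_complexify_comp hv2).toLp _) with hVdef
  have hV : IsDistributionOf v V := isDistributionOf_toTemperedDistribution hv2
  have h1 : eLpNorm v 3 volume = eLpNormDistrib 3 V := (hV.eLpNormDistrib_eq hv3).symm
  have h0 : Tendsto (fun j : ℤ => lowFreqCutoff j V) atBot (𝓝 0) :=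
    tendsto_lowFreqCutoff_of_memLp_two_holds hv2 hV
  have h2 : eLpNormDistrib 3 V ≤ ∑' j : ℤ, eLpNormDistrib 3 (lpBlock j V) := eLpNormDistrib_le_tsum_lpBlock _ h0
  rw [h1]
  refine h2.trans_eq (tsum_congr fun j => ?_)
  exact hV.eLpNormDistrib_lpBlock_eq hv2 j (memLp_blockFn j hv3 (by norm_num))

/-- **Interpolation on a block**: `‖Δ̇_j v‖₃³ ≤ ‖Δ̇_j v‖_∞ · ‖Δ̇_j v‖₂² = s_j a_j²` (pull one factor out by the
essential supremum, `lintegral_enorm_pow_add_le_essSup_pow_mul`). [folklore] -/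
theorem block_three_pow_le (v : EuclideanSpace ℝ (Fin 3) → EuclideanSpace ℝ (Fin 3)) (j : ℤ)
    (hv : AEStronglyMeasurable (blockFn j v) volume) :
    eLpNorm (blockFn j v) 3 volume ^ 3 ≤ blockSup v j * blockL2 v j ^ 2 := by
  have h3 := eLpNorm_natCast_pow_eq_lintegral volume (blockFn j v) (n := 3) (by norm_num)
  have h2 := eLpNorm_natCast_pow_eq_lintegral volume (blockFn j v) (n := 2) (by norm_num)
  simp only [Nat.cast_ofNat] at h3 h2
  rw [blockSup, blockL2, h3, h2, eLpNorm_exponent_top]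
  have h := lintegral_enorm_pow_add_le_essSup_pow_mul (μ := volume) hv 1 2
  simpa only [pow_one, Nat.reduceAdd] using h

/-- **The cube root form**: `‖Δ̇_j v‖₃ ≤ (s_j a_j²)^{1/3}`. [folklore] -/
theorem block_three_le_rpow (v : EuclideanSpace ℝ (Fin 3) → EuclideanSpace ℝ (Fin 3)) (j : ℤ)
    (hv : AEStronglyMeasurable (blockFn j v) volume) :
    eLpNorm (blockFn j v) 3 volume ≤ (blockSup v j * blockL2 v j ^ 2) ^ (1 / 3 : ℝ) := by
  have h := block_three_pow_le v j hv
  calc eLpNorm (blockFn j v) 3 volume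
      = ((eLpNorm (blockFn j v) 3 volume) ^ 3) ^ (1 / 3 : ℝ) := by
        rw [← ENNReal.rpow_natCast, ← ENNReal.rpow_mul]
        norm_num
    _ ≤ (blockSup v j * blockL2 v j ^ 2) ^ (1 / 3 : ℝ) := ENNReal.rpow_le_rpow h (by norm_num)

/-- **THE CRITICAL SIZE IN THE DICTIONARY'S OWN CURRENCIES**: for `v ∈ L² ∩ L³(ℝ³; ℝ³)`,
`‖v‖_{L³} ≤ ∑_{j∈ℤ} (s_j a_j²)^{1/3}`, `s_j = ‖Δ̇_j v‖_∞`, `a_j = ‖Δ̇_j v‖₂` (Littlewood–Paley summation in `L³` and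
interpolation block by block). Each summand is invariant under the Navier–Stokes scaling.
[cite: BahouriCheminDanchin2011, Prop. 2.12] -/
theorem eLpNorm_three_le_tsum_mixed {v : EuclideanSpace ℝ (Fin 3) → EuclideanSpace ℝ (Fin 3)}
    (hv2 : MemLp v 2 volume) (hv3 : MemLp v 3 volume) :
    eLpNorm v 3 volume ≤ ∑' j : ℤ, (blockSup v j * blockL2 v j ^ 2) ^ (1 / 3 : ℝ) :=
  (eLpNorm_three_le_tsum_block hv2 hv3).trans
    (ENNReal.tsum_le_tsum fun j => block_three_le_rpow v j (memLp_blockFn j hv3 (by norm_num)).1)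

/-- **Bernstein on the critical summand**: with the absolute Bernstein constant `C_B` of
`BlockAmplitudeCeiling.exists_blockSup_le_blockL2` (`s_j ≤ C_B 2^{3j/2} a_j`), for every `v ∈ L²` and every level
`j`: `(s_j a_j²)^{1/3} ≤ C_B^{1/3} 2^{j/2} a_j`. [cite: BahouriCheminDanchin2011, Lemma 2.1] -/
theorem exists_mixed_le_besovHalf :
    ∃ C : ℝ≥0, ∀ (v : EuclideanSpace ℝ (Fin 3) → EuclideanSpace ℝ (Fin 3)), MemLp v 2 volume →
      ∀ j : ℤ, (blockSup v j * blockL2 v j ^ 2) ^ (1 / 3 : ℝ) ≤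
        C * ((2 : ℝ≥0∞) ^ ((j : ℝ) / 2) * blockL2 v j) := by
  obtain ⟨CB, -, hB⟩ := exists_blockSup_le_blockL2
  refine ⟨CB ^ (1 / 3 : ℝ), fun v hv j => ?_⟩
  set a : ℝ≥0∞ := blockL2 v j with ha
  have h1 : blockSup v j * a ^ 2 ≤ ((CB : ℝ≥0∞) * (2 : ℝ≥0∞) ^ (3 * (j : ℝ) / 2)) * a ^ 3 :=
    calc blockSup v j * a ^ 2 ≤ ((CB : ℝ≥0∞) * (2 : ℝ≥0∞) ^ (3 * (j : ℝ) / 2) * a) * a ^ 2 :=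
          mul_le_mul' (hB v hv j) le_rfl
      _ = ((CB : ℝ≥0∞) * (2 : ℝ≥0∞) ^ (3 * (j : ℝ) / 2)) * a ^ 3 := by ring
  have h2 := ENNReal.rpow_le_rpow h1 (by norm_num : (0 : ℝ) ≤ 1 / 3)
  refine h2.trans_eq ?_
  have h3 : (a ^ 3) ^ (1 / 3 : ℝ) = a := by
    rw [← ENNReal.rpow_natCast, ← ENNReal.rpow_mul]
    norm_num
  have h4 : ((2 : ℝ≥0∞) ^ (3 * (j : ℝ) / 2)) ^ (1 / 3 : ℝ) = (2 : ℝ≥0∞) ^ ((j : ℝ) / 2) := by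
    rw [← ENNReal.rpow_mul]
    congr 1
    ring
  have h5 : ((CB : ℝ≥0∞)) ^ (1 / 3 : ℝ) = ((CB ^ (1 / 3 : ℝ) : ℝ≥0) : ℝ≥0∞) :=
    (ENNReal.coe_rpow_of_nonneg _ (by norm_num)).symm
  rw [ENNReal.mul_rpow_of_nonneg _ _ (by norm_num), ENNReal.mul_rpow_of_nonneg _ _ (by norm_num), h3, h4, h5,
    mul_assoc]

/-- **THE CRITICAL SIZE IN `Ḃ^{1/2}_{2,1}` CURRENCY**: there is an absolute constant `C` (`= C_B^{1/3}`) with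
`‖v‖_{L³} ≤ C ∑_{j∈ℤ} 2^{j/2} ‖Δ̇_j v‖₂` for every `v ∈ L² ∩ L³(ℝ³; ℝ³)` (`eLpNorm_three_le_tsum_mixed` and Bernstein,
`exists_mixed_le_besovHalf`) — the embedding `Ḃ^{1/2}_{2,1} ⊂ L³` at function level.
[cite: BahouriCheminDanchin2011, Lemma 2.1 and Prop. 2.12] -/
theorem exists_eLpNorm_three_le_tsum_besovHalf :
    ∃ C : ℝ≥0, ∀ (v : EuclideanSpace ℝ (Fin 3) → EuclideanSpace ℝ (Fin 3)), MemLp v 2 volume → MemLp v 3 volume →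
      eLpNorm v 3 volume ≤ C * ∑' j : ℤ, (2 : ℝ≥0∞) ^ ((j : ℝ) / 2) * blockL2 v j := by
  obtain ⟨C, hC⟩ := exists_mixed_le_besovHalf
  refine ⟨C, fun v hv2 hv3 => (eLpNorm_three_le_tsum_mixed hv2 hv3).trans ?_⟩
  rw [← ENNReal.tsum_mul_left]
  exact ENNReal.tsum_le_tsum fun j => hC v hv2 j

/-! ## L29: the critical level floors at every instant -/

/-- **L29 — THE CRITICAL LEVEL FLOOR, MIXED CURRENCY.** With Kato's constant `δ` of `CriticalFloor.eLpNorm_three_floor`: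
along every maximal smooth Leray–Hopf solution of the unforced system (`ν > 0`), at EVERY `t ∈ (0, T)`,
`δ ν < ∑_{j∈ℤ} (s_j(t) a_j(t)²)^{1/3}`, `s_j(t) = ‖Δ̇_j u(t)‖_∞`, `a_j(t) = ‖Δ̇_j u(t)‖₂` — the level table is never
critically small: its scale-free row `(s_j a_j²)^{1/3}`, summed, stays above an absolute multiple of `ν` at every
instant of the life of a realised blow-up. (L28 and `eLpNorm_three_le_tsum_mixed`; the slice is in `L² ∩ L³`,
`CriticalDivergence.memLp_three_slice`.) [cite: Kato1984MathZ, Thms. 2 and 4]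
[cite: BahouriCheminDanchin2011, Prop. 2.12] -/
theorem mixed_level_floor :
    ∃ δ : ℝ, 0 < δ ∧ ∀ (ν T : ℝ), 0 < ν → 0 < T →
      ∀ (u : ℝ → EuclideanSpace ℝ (Fin 3) → EuclideanSpace ℝ (Fin 3)) (p : ℝ → EuclideanSpace ℝ (Fin 3) → ℝ),
      IsMaximalSmoothSolution ν 0 u p T → IsLerayHopfOn T ν 0 (u 0) u →
      ∀ t ∈ Ioo 0 T, ENNReal.ofReal (δ * ν) <
        ∑' j : ℤ, (blockSup (u t) j * blockL2 (u t) j ^ 2) ^ (1 / 3 : ℝ) := by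
  obtain ⟨δ, hδ, H⟩ := eLpNorm_three_floor
  refine ⟨δ, hδ, fun ν T hν hT u p hmax hLH t ht => (H ν T hν hT u p hmax hLH t ht).trans_le ?_⟩
  exact eLpNorm_three_le_tsum_mixed (hLH.memLp t ⟨ht.1.le, ht.2.le⟩) (memLp_three_slice hν hT hmax.1 hLH ht)

/-- **L29 — THE CRITICAL LEVEL FLOOR, `Ḃ^{1/2}_{2,1}` CURRENCY.** There is an absolute `δ'' > 0` such that along
every maximal smooth Leray–Hopf solution of the unforced system (`ν > 0`), at EVERY `t ∈ (0, T)`: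
`δ'' ν < ∑_{j∈ℤ} 2^{j/2} ‖Δ̇_j u(t)‖₂` — the critically weighted block energies, summed, stay above an absolute
multiple of `ν`. `δ'' = δ/(C + 1)` with Kato's `δ` (L28) and the constant `C = C_B^{1/3}` of
`exists_eLpNorm_three_le_tsum_besovHalf`. [cite: Kato1984MathZ, Thms. 2 and 4]
[cite: BahouriCheminDanchin2011, Lemma 2.1 and Prop. 2.12] -/
theorem besovHalf_level_floor :
    ∃ δ'' : ℝ, 0 < δ'' ∧ ∀ (ν T : ℝ), 0 < ν → 0 < T →
      ∀ (u : ℝ → EuclideanSpace ℝ (Fin 3) → EuclideanSpace ℝ (Fin 3)) (p : ℝ → EuclideanSpace ℝ (Fin 3) → ℝ),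
      IsMaximalSmoothSolution ν 0 u p T → IsLerayHopfOn T ν 0 (u 0) u →
      ∀ t ∈ Ioo 0 T, ENNReal.ofReal (δ'' * ν) < ∑' j : ℤ, (2 : ℝ≥0∞) ^ ((j : ℝ) / 2) * blockL2 (u t) j := by
  obtain ⟨δ, hδ, H⟩ := eLpNorm_three_floor
  obtain ⟨C, hC⟩ := exists_eLpNorm_three_le_tsum_besovHalf
  have hC1 : (0 : ℝ) < C + 1 := by positivity
  refine ⟨δ / (C + 1), div_pos hδ hC1, fun ν T hν hT u p hmax hLH t ht => ?_⟩
  set S : ℝ≥0∞ := ∑' j : ℤ, (2 : ℝ≥0∞) ^ ((j : ℝ) / 2) * blockL2 (u t) j with hS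
  have hfloor := H ν T hν hT u p hmax hLH t ht
  have hemb : eLpNorm (u t) 3 volume ≤ ((C + 1 : ℝ≥0) : ℝ≥0∞) * S := by
    refine (hC _ (hLH.memLp t ⟨ht.1.le, ht.2.le⟩) (memLp_three_slice hν hT hmax.1 hLH ht)).trans ?_
    refine mul_le_mul' ?_ le_rfl
    exact_mod_cast le_add_of_nonneg_right zero_le_one
  have hlt : ENNReal.ofReal (δ * ν) < ((C + 1 : ℝ≥0) : ℝ≥0∞) * S := hfloor.trans_le hemb
  have hC1' : ((C + 1 : ℝ≥0) : ℝ≥0∞) ≠ 0 := by exact_mod_cast hC1.ne'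
  have hC1top : ((C + 1 : ℝ≥0) : ℝ≥0∞) ≠ ⊤ := ENNReal.coe_ne_top
  have hdiv : ENNReal.ofReal (δ / (C + 1) * ν) = ENNReal.ofReal (δ * ν) / ((C + 1 : ℝ≥0) : ℝ≥0∞) := by
    rw [div_mul_eq_mul_div, ENNReal.ofReal_div_of_pos hC1]
    congr 1
    rw [ENNReal.ofReal_add (NNReal.coe_nonneg C) zero_le_one, ENNReal.ofReal_coe_nnreal, ENNReal.ofReal_one]
    push_cast
    rfl
  rw [hdiv, ENNReal.div_lt_iff (Or.inl hC1') (Or.inl hC1top)]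
  exact hlt.trans_eq (mul_comm _ _)

/-! ## L29′: the critical level divergence -/

/-- **L29′ — THE CRITICAL LEVEL DIVERGENCE, MIXED CURRENCY.** Along every maximal smooth Leray–Hopf solution of
the unforced system (`ν > 0`): `∑_{j∈ℤ} (s_j(t) a_j(t)²)^{1/3} → ∞` as `t ↑ T` (L27 and `eLpNorm_three_le_tsum_mixed`).
Scale-free: no rate, no `ν`. [cite: Seregin2012, Thm. 1.1] [cite: BahouriCheminDanchin2011, Prop. 2.12] -/
theorem mixed_level_tendsto_top {ν T : ℝ} (hν : 0 < ν) (hT : 0 < T)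
    {u : ℝ → EuclideanSpace ℝ (Fin 3) → EuclideanSpace ℝ (Fin 3)} {p : ℝ → EuclideanSpace ℝ (Fin 3) → ℝ}
    (hmax : IsMaximalSmoothSolution ν 0 u p T) (hLH : IsLerayHopfOn T ν 0 (u 0) u) :
    Tendsto (fun t => ∑' j : ℤ, (blockSup (u t) j * blockL2 (u t) j ^ 2) ^ (1 / 3 : ℝ)) (𝓝[<] T) (𝓝 ∞) := by
  refine tendsto_nhds_top_mono (eLpNorm_three_tendsto_top hν hT hmax hLH) ?_
  filter_upwards [Ioo_mem_nhdsLT hT] with t ht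
  exact eLpNorm_three_le_tsum_mixed (hLH.memLp t ⟨ht.1.le, ht.2.le⟩) (memLp_three_slice hν hT hmax.1 hLH ht)

/-- **L29′ — THE CRITICAL LEVEL DIVERGENCE, `Ḃ^{1/2}_{2,1}` CURRENCY.** Along every maximal smooth Leray–Hopf
solution of the unforced system (`ν > 0`): `∑_{j∈ℤ} 2^{j/2} ‖Δ̇_j u(t)‖₂ → ∞` as `t ↑ T` (L27,
`exists_eLpNorm_three_le_tsum_besovHalf`, and the finiteness of the Bernstein constant). Scale-free.
[cite: Seregin2012, Thm. 1.1] [cite: BahouriCheminDanchin2011, Lemma 2.1 and Prop. 2.12] -/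
theorem besovHalf_level_tendsto_top {ν T : ℝ} (hν : 0 < ν) (hT : 0 < T)
    {u : ℝ → EuclideanSpace ℝ (Fin 3) → EuclideanSpace ℝ (Fin 3)} {p : ℝ → EuclideanSpace ℝ (Fin 3) → ℝ}
    (hmax : IsMaximalSmoothSolution ν 0 u p T) (hLH : IsLerayHopfOn T ν 0 (u 0) u) :
    Tendsto (fun t => ∑' j : ℤ, (2 : ℝ≥0∞) ^ ((j : ℝ) / 2) * blockL2 (u t) j) (𝓝[<] T) (𝓝 ∞) := by
  obtain ⟨C, hC⟩ := exists_eLpNorm_three_le_tsum_besovHalf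
  refine tendsto_top_of_le_const_mul (C := C) (eLpNorm_three_tendsto_top hν hT hmax hLH) ?_
  filter_upwards [Ioo_mem_nhdsLT hT] with t ht
  exact hC _ (hLH.memLp t ⟨ht.1.le, ht.2.le⟩) (memLp_three_slice hν hT hmax.1 hLH ht)

/-! ## L29″: the divergence sits above every fixed level -/

/-- **Splitting a sum over the levels at `J`**: `∑_{j∈ℤ} f j = ∑_{n≥0} f (J−1−n) + ∑_{n≥0} f (J+n)`. [folklore] -/
theorem tsum_int_eq_low_add_tail (f : ℤ → ℝ≥0∞) (J : ℤ) :
    ∑' j : ℤ, f j = (∑' n : ℕ, f (J - 1 - n)) + ∑' n : ℕ, f (J + n) := by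
  rw [← (Equiv.addRight J).tsum_eq]
  simp only [Equiv.coe_addRight]
  rw [tsum_of_nat_of_neg_add_one ENNReal.summable ENNReal.summable, add_comm]
  congr 1
  · refine tsum_congr fun n => ?_
    congr 1
    ring
  · refine tsum_congr fun n => ?_
    rw [add_comm]

/-- **The critically weighted block energies BELOW a level are controlled by the energy**: for `v ∈ L²` and
`J ∈ ℤ`, `∑_{n≥0} 2^{(J−1−n)/2} ‖Δ̇_{J−1−n} v‖₂ ≤ C₂ ‖v‖₂ 2^{(J−1)/2} ∑_n 2^{−n/2}` (`‖Δ̇_l v‖₂ ≤ C₂‖v‖₂`, the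
toolbox `lpBounds`), a finite quantity. [cite: BahouriCheminDanchin2011, Prop. 2.12] -/
theorem tsum_besovHalf_low_le {v : EuclideanSpace ℝ (Fin 3) → EuclideanSpace ℝ (Fin 3)} (hv : MemLp v 2 volume)
    (J : ℤ) :
    ∑' n : ℕ, (2 : ℝ≥0∞) ^ (((J - 1 - n : ℤ) : ℝ) / 2) * blockL2 v (J - 1 - n) ≤
      ((lpBounds (Fin 3)).C₂ : ℝ≥0∞) * eLpNorm v 2 volume * (2 : ℝ≥0∞) ^ (((J - 1 : ℤ) : ℝ) / 2) *
        ∑' n : ℕ, ((2 : ℝ≥0∞) ^ (-(1 / 2 : ℝ))) ^ n := by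
  set K := lpBounds (Fin 3) with hK
  have hterm : ∀ n : ℕ, (2 : ℝ≥0∞) ^ (((J - 1 - n : ℤ) : ℝ) / 2) * blockL2 v (J - 1 - n) ≤
      (K.C₂ : ℝ≥0∞) * eLpNorm v 2 volume *
        ((2 : ℝ≥0∞) ^ (((J - 1 : ℤ) : ℝ) / 2) * ((2 : ℝ≥0∞) ^ (-(1 / 2 : ℝ))) ^ n) := by
    intro n
    have ha : blockL2 v (J - 1 - n) ≤ (K.C₂ : ℝ≥0∞) * eLpNorm v 2 volume := K.blockL2_le hv _
    have hw : (2 : ℝ≥0∞) ^ (((J - 1 - n : ℤ) : ℝ) / 2) =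
        (2 : ℝ≥0∞) ^ (((J - 1 : ℤ) : ℝ) / 2) * ((2 : ℝ≥0∞) ^ (-(1 / 2 : ℝ))) ^ n := by
      rw [← ENNReal.rpow_natCast, ← ENNReal.rpow_mul, ← ENNReal.rpow_add _ _ two_ne_zero ENNReal.ofNat_ne_top]
      congr 1
      push_cast
      ring
    rw [hw]
    calc (2 : ℝ≥0∞) ^ (((J - 1 : ℤ) : ℝ) / 2) * ((2 : ℝ≥0∞) ^ (-(1 / 2 : ℝ))) ^ n * blockL2 v (J - 1 - n)
        ≤ (2 : ℝ≥0∞) ^ (((J - 1 : ℤ) : ℝ) / 2) * ((2 : ℝ≥0∞) ^ (-(1 / 2 : ℝ))) ^ n *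
            ((K.C₂ : ℝ≥0∞) * eLpNorm v 2 volume) := mul_le_mul' le_rfl ha
      _ = _ := by ring
  calc ∑' n : ℕ, (2 : ℝ≥0∞) ^ (((J - 1 - n : ℤ) : ℝ) / 2) * blockL2 v (J - 1 - n)
      ≤ ∑' n : ℕ, (K.C₂ : ℝ≥0∞) * eLpNorm v 2 volume *
          ((2 : ℝ≥0∞) ^ (((J - 1 : ℤ) : ℝ) / 2) * ((2 : ℝ≥0∞) ^ (-(1 / 2 : ℝ))) ^ n) := ENNReal.tsum_le_tsum hterm
    _ = _ := by rw [ENNReal.tsum_mul_left, ENNReal.tsum_mul_left, ← mul_assoc]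

/-- The geometric factor `∑_n 2^{−n/2}` is finite. [folklore] -/
theorem tsum_geom_half_lt_top : ∑' n : ℕ, ((2 : ℝ≥0∞) ^ (-(1 / 2 : ℝ))) ^ n < ∞ := by
  rw [ENNReal.tsum_geometric, ENNReal.inv_lt_top, tsub_pos_iff_lt, ENNReal.rpow_neg, ENNReal.inv_lt_one]
  exact ENNReal.one_lt_rpow (by norm_num) (by norm_num)

/-- **L29″ — IN THE CRITICAL CURRENCY THE BLOW-UP LIVES ABOVE EVERY FIXED LEVEL.** Along every maximal smooth
Leray–Hopf solution of the unforced system (`ν > 0`), for EVERY level `J ∈ ℤ`: the critically weighted block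
energies above `J`, `∑_{n≥0} 2^{(J+n)/2} ‖Δ̇_{J+n} u(t)‖₂`, tend to `∞` as `t ↑ T`. The levels below `J` hold at most
`C₂ ‖u(0)‖₂ 2^{(J−1)/2} ∑_n 2^{−n/2} < ∞` at every time (`tsum_besovHalf_low_le` and Leray's energy inequality
`‖u(t)‖₂ ≤ ‖u(0)‖₂`), so the divergence of L29′ sits in the tail. By Cauchy–Schwarz this tail dominates
`2^{(J−1)/2} (∑_{n≥0} 4^{J+n} a_{J+n}²)^{1/2}`: the statement sharpens the enstrophy-tail divergence L26, with
scale-free weights. [cite: Seregin2012, Thm. 1.1] [cite: BahouriCheminDanchin2011, Lemma 2.1 and Prop. 2.12] -/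
theorem besovHalf_tail_tendsto_top {ν T : ℝ} (hν : 0 < ν) (hT : 0 < T)
    {u : ℝ → EuclideanSpace ℝ (Fin 3) → EuclideanSpace ℝ (Fin 3)} {p : ℝ → EuclideanSpace ℝ (Fin 3) → ℝ}
    (hmax : IsMaximalSmoothSolution ν 0 u p T) (hLH : IsLerayHopfOn T ν 0 (u 0) u) (J : ℤ) :
    Tendsto (fun t => ∑' n : ℕ, (2 : ℝ≥0∞) ^ (((J + n : ℤ) : ℝ) / 2) * blockL2 (u t) (J + n))
      (𝓝[<] T) (𝓝 ∞) := by
  set K := lpBounds (Fin 3) with hK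
  -- the head bound, uniform in time
  set H : ℝ≥0∞ := (K.C₂ : ℝ≥0∞) * eLpNorm (u 0) 2 volume * (2 : ℝ≥0∞) ^ (((J - 1 : ℤ) : ℝ) / 2) *
    ∑' n : ℕ, ((2 : ℝ≥0∞) ^ (-(1 / 2 : ℝ))) ^ n with hH
  have hu0 : MemLp (u 0) 2 volume := hLH.memLp 0 ⟨le_rfl, hT.le⟩
  have h2top : (2 : ℝ≥0∞) ^ (((J - 1 : ℤ) : ℝ) / 2) ≠ ⊤ := by
    rw [Ne, ENNReal.rpow_eq_top_iff]
    norm_num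
  have hHtop : H ≠ ⊤ :=
    ENNReal.mul_ne_top (ENNReal.mul_ne_top (ENNReal.mul_ne_top ENNReal.coe_ne_top hu0.eLpNorm_ne_top) h2top)
      tsum_geom_half_lt_top.ne
  refine tendsto_top_of_le_add hHtop (besovHalf_level_tendsto_top hν hT hmax hLH) ?_
  filter_upwards [Ioo_mem_nhdsLT hT] with t ht
  have hut : MemLp (u t) 2 volume := hLH.memLp t ⟨ht.1.le, ht.2.le⟩
  rw [tsum_int_eq_low_add_tail (fun j => (2 : ℝ≥0∞) ^ ((j : ℝ) / 2) * blockL2 (u t) j) J]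
  refine add_le_add ?_ le_rfl
  refine (tsum_besovHalf_low_le hut J).trans ?_
  rw [hH]
  gcongr
  exact hLH.eLpNorm_le_eLpNorm_datum hν.le hu0 ⟨ht.1.le, ht.2.le⟩

end Summit.NavierStokesRegularity.FluidComputer.CriticalLevels

end
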